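import Summits.Parity.GeneralizedHardyLittlewood.Theses.EntropyRate

/-!
# Birth skeleton (BC3) — crux stmt-Parity-17879 `Theses.EntropyRate.ChowlaFixed` (node, rank 9)
# line `birth`: DYADIC FAIRNESS at every large scale + prime-lag Chowla ⟹ binary Chowla at
# natural density, by a PROVED finitary descent (dilation identity, one pigeonholed bin of primes,
# 1-Lipschitz correlation sums)

Registered by the skeleton registrar (planner one-shot `planner-skel-stmt-Parity-17879-0`,
2026-08-17; BC3 of `run/shared/lean/lens3/_common/BC.md`). Route `route-Parity-EntropyRate`
(sub-problem `GeneralizedHardyLittlewood`). Two NAMED stubs and the kernel-checked composition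
`ChowlaFixed_of` concluding the crux BY NAME (a real proof, ≈ 250 lines, no `sorry`);
`ChowlaFixed_proof` plugs the stubs in.

## The crux (FIXED; verbatim the route decl)

`ChowlaFixed`: for every `h ≥ 1`, `S_h(N) := ∑_{n=1}^{N} λ(n)λ(n+h) = o(N)` (`N → ∞` in `ℕ`, the
`ℤ`-product cast to `ℝ`) — binary Chowla at NATURAL density, fixed shift. On the route it is the
node between the door `UniformEntropyRate` (via `EntropyTransfer`, stmt-Parity-17880) and `PairsHL`.

## The cut — Tao's dilation trick at natural scale, with the scale change made explicit

For a prime `p`, complete multiplicativity (`λ(p)² = 1`) gives the EXACT identity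
`∑_{m ≤ Y, p ∣ m} λ(m)λ(m+ph) = S_h(⌊Y/p⌋)` (`sum_filter_dvd_eq_corr`), hence
`∑_{m ≤ Y} (p·1_{p∣m} − 1) λ(m)λ(m+ph) = p·S_h(⌊Y/p⌋) − S_{ph}(Y)` (`fair_inner_eq`): the
"fairness" functional of the entropy method (Tao 2016 §3; Tao–Teräväinen 2019 §5, where it is
literally `f_{dp}(1) − f_d(p) = E^{(d)} g(0)g(ph)(p 1_{p∣n} − 1) + O(ε)`, Prop. 5.1, p. 26) compares
the correlation at lag `h` and scale `Y/p` with the correlation at lag `ph` and scale `Y`. At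
logarithmic scale the two scales coincide (dilation invariance of `dn/n`); at natural scale they
do not, and that is the whole difficulty of the node. The skeleton cuts the crux into

* `stub_dyadicFairness` (F, OPEN — the load-bearing stub): for every `h ≥ 1`, `ε > 0` and `P₁`
  there is a dyadic block of primes `𝒫 = {P ≤ p < 2P}`, `P ≥ P₁`, which is `ε`-FAIR against
  `λ(m)λ(m+ph)` at EVERY large scale: `∃ Y₀ ∀ Y ≥ Y₀, ∑_{p∈𝒫} |∑_{m≤Y} (p·1_{p∣m} − 1)λ(m)λ(m+ph)| ≤ ε·Y·#𝒫`.
  This is the finitary form of Tao–Teräväinen's "improved approximate isotopy formula"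
  `sup_d E_{2^m ≤ p < 2^{m+1}} |f_{dp}(1) − f_d(p)| ≤ ε` (arXiv:1809.02518 Prop. 5.1) WITHOUT their
  few-sign-patterns hypothesis; Tao 2016 proves it at logarithmic scale (entropy decrement,
  Lemma 3.2 + Lemma 3.3), Helfgott–Radziwiłł (arXiv:2103.06853) at a fixed scale for prime sets with
  `∑ 1/p → ∞`; for ONE dyadic block at ALL large natural scales it is open, and it is exactly what the
  route's lever `EntropyTransfer` must deliver from the door (`UniformEntropyRate ⟹ F` is the
  information-theoretic half of stmt-Parity-17880; see `Lines/birth.md`, "Disproof used / caveat" for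
  the quantifier-order caveat on `k` found while registering). Why it might fail: a "diagonal
  conspiracy" of λ against `n mod p` at scales `≍ pY` is consistent with every log-averaged theorem
  (Tao 2016 p. 15); the stub is implied by `ChowlaFixed` itself (both terms are binary Chowla sums),
  so it is true iff the crux is — it is a TRANSFER of the crux to the independence statement the
  entropy / expander tools act on, not a weakening.
* `stub_primeLagChowla` (M, KNOWN — the route's support item stmt-Parity-17878 BY NAME):
  `∑_{p∈𝒫} |S_{ph}(Y)| ≤ ε·Y·#𝒫` for `P ≥ P₀(h,ε)`, `Y ≥ Y₀(P)` — Matomäki–Radziwiłł–Tao via Tao 2016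
  Lemmas 3.6–3.7 + (2.9) with ARBITRARY unit coefficients `c_p` (restriction theorem for the primes),
  hence with the absolute values inside; vendored in the printed signed form as
  `Literature.NumberTheory.Sieve.taoTeravainen2019_primeLag_liouville`.

Composition `ChowlaFixed_of : F → M → ChowlaFixed` (REAL proof, this file). Fix `h`, `c ∈ (0,1]`;
put `δ = c/3`, `ε = c²/144`. Take `P₀(h,ε)` from M and a fair block `𝒫 ⊂ [P,2P)` with
`P ≥ max(P₀, ⌈2/δ⌉+2)` from F (non-empty by Bertrand). F + M at a scale `Y` give, by `fair_inner_eq`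
and the triangle inequality, `(3) ∑_{p∈𝒫} p·|S_h(⌊Y/p⌋)| ≤ 2εY#𝒫`. Cut `[P,2P)` into bins of width
`w = ⌊δP⌋`; there are `≤ P/w + 1 ≤ 3/δ` of them, so by PIGEONHOLE one bin `B` holds `≥ (δ/3)#𝒫`
primes of `𝒫`; fix `p₀ ∈ B`. For `N` large apply (3) at the single scale `Y = p₀N` and keep only
`p ∈ B`: there `|⌊p₀N/p⌋ − N| ≤ δN + 1` (`abs_div_cast_sub_le`, `abs_sub_lt_of_div_eq`) and `S_h` is
1-Lipschitz (`abs_corr_sub_le`), so each kept term is `≥ P(|S_h(N)| − δN − 1)`, whence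
`|S_h(N)| ≤ δN + 1 + 12εN/δ = (7c/12)N + 1 ≤ cN` for `N ≥ 3/c`. No prime number theorem is needed.

Sanity (no `sorry`): `chowlaFixed_iff` (`Iff.rfl` spelling certificate of the crux),
`sum_filter_dvd_eq_corr`, `fair_inner_eq`, `lam2_dilate`. BC3 probes (registrar folder
`bc/probes.lean`, `bc/probes2.lean`): `stub → ChowlaFixed` and `stub → GeneralizedHardyLittlewood`
for both stubs by `first | exact? | simpa | aesop` (and the unfolded / `exact?` variants) all FAIL.

Disproof / negatives: no `Disproof.lean` for this crux (`ledger crux ls stmt-Parity-17879`: ideas +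
evidence only); the landed Negative lemma
`Theorems.ChowlaFixed.Negative.chowlaFixed_false_without_shiftPos` (h = 0 is false) is honoured —
both stubs and the composition carry `1 ≤ h` and never touch `h = 0`. Negatives index (Parity): no
λ-autocorrelation statement. Barriers: `Literature.Barriers.Parity.LogarithmicAveraging` — NOT
evaded by the skeleton (F is a natural-density statement: that is the crux's and the route's
declared bet; nothing is transferred from a logarithmic mean); `SiegelZeroTwinPrimes` /
`SiegelZeroDichotomy` — not entered (fixed shift, no uniformity in `h`); sieve / Gowers / circle
barriers — not in their classes (pure λ-correlations and divisibility by one prime).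
-/

set_option linter.dupNamespace false

noncomputable section

open scoped BigOperators

namespace Summit.Parity.GeneralizedHardyLittlewood.Cruxes.ChowlaFixed.Birth

open Summit.Parity.GeneralizedHardyLittlewood.Theses.EntropyRate (ChowlaFixed PrimeLagChowla)

/-! ## In-file vocabulary for the composition (NOT used in the stub signatures) -/

/-- `λ(a)λ(b)` as a real number (the crux's summand, verbatim its cast shape). -/
def lam2 (a b : ℕ) : ℝ :=
  (((ArithmeticFunction.liouville a * ArithmeticFunction.liouville b : ℤ)) : ℝ)

/-- The two-point Liouville correlation `S_h(N) = ∑_{n=1}^{N} λ(n)λ(n+h)`. -/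
def corr (h N : ℕ) : ℝ :=
  ∑ n ∈ Finset.Icc 1 N, lam2 n (n + h)

/-- Spelling certificate: the crux is `∀ h ≥ 1, S_h = o(N)` symbol by symbol. -/
theorem chowlaFixed_iff :
    ChowlaFixed ↔ ∀ h : ℕ, 1 ≤ h → (fun N : ℕ => corr h N) =o[Filter.atTop] fun N : ℕ => (N : ℝ) :=
  Iff.rfl

theorem abs_liouville_int_le_one (n : ℕ) : |(ArithmeticFunction.liouville n : ℤ)| ≤ 1 := by
  by_cases hn : n = 0
  · subst hn
    simp
  · rw [ArithmeticFunction.liouville_apply hn, abs_pow, abs_neg, abs_one, one_pow]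

theorem abs_lam2_le_one (a b : ℕ) : |lam2 a b| ≤ 1 := by
  unfold lam2
  rw [Int.cast_mul, abs_mul]
  have ha : |((ArithmeticFunction.liouville a : ℤ) : ℝ)| ≤ 1 := by
    exact_mod_cast abs_liouville_int_le_one a
  have hb : |((ArithmeticFunction.liouville b : ℤ) : ℝ)| ≤ 1 := by
    exact_mod_cast abs_liouville_int_le_one b
  exact mul_le_one₀ ha (abs_nonneg _) hb

/-- `S_h` is 1-Lipschitz in the length. -/
theorem abs_corr_sub_le_of_le (h : ℕ) {a b : ℕ} (hba : b ≤ a) :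
    |corr h a - corr h b| ≤ (a : ℝ) - b := by
  have hsub : Finset.Icc 1 b ⊆ Finset.Icc 1 a := Finset.Icc_subset_Icc_right hba
  have hsplit := Finset.sum_sdiff hsub (f := fun n => lam2 n (n + h))
  have hdiff : corr h a - corr h b = ∑ n ∈ Finset.Icc 1 a \ Finset.Icc 1 b, lam2 n (n + h) := by
    unfold corr
    linarith
  have hcard : (((Finset.Icc 1 a \ Finset.Icc 1 b).card : ℕ) : ℝ) = (a : ℝ) - b := by
    have h1 := Finset.card_sdiff_add_card_eq_card hsub
    rw [Nat.card_Icc, Nat.card_Icc] at h1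
    have h2 : (Finset.Icc 1 a \ Finset.Icc 1 b).card = a - b := by omega
    rw [h2, Nat.cast_sub hba]
  rw [hdiff]
  calc |∑ n ∈ Finset.Icc 1 a \ Finset.Icc 1 b, lam2 n (n + h)|
      ≤ ∑ n ∈ Finset.Icc 1 a \ Finset.Icc 1 b, |lam2 n (n + h)| := Finset.abs_sum_le_sum_abs _ _
    _ ≤ ∑ n ∈ Finset.Icc 1 a \ Finset.Icc 1 b, (1 : ℝ) :=
        Finset.sum_le_sum fun n _ => abs_lam2_le_one _ _
    _ = (((Finset.Icc 1 a \ Finset.Icc 1 b).card : ℕ) : ℝ) := by simp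
    _ = (a : ℝ) - b := hcard

theorem abs_corr_sub_le (h a b : ℕ) : |corr h a - corr h b| ≤ |(a : ℝ) - b| := by
  rcases le_total b a with hba | hab
  · exact (abs_corr_sub_le_of_le h hba).trans (le_abs_self _)
  · rw [abs_sub_comm, abs_sub_comm (a : ℝ)]
    exact (abs_corr_sub_le_of_le h hab).trans (le_abs_self _)

theorem liouville_mul_self_eq_one {p : ℕ} (hp : p ≠ 0) :
    (ArithmeticFunction.liouville p : ℤ) * ArithmeticFunction.liouville p = 1 := by
  rw [ArithmeticFunction.liouville_apply hp, ← pow_add, ← two_mul, pow_mul, neg_one_sq, one_pow]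

/-- Complete multiplicativity: `λ(pn)λ(pn+ph) = λ(n)λ(n+h)` (`λ(p)² = 1`). -/
theorem lam2_dilate {p : ℕ} (hp : p ≠ 0) (n h : ℕ) :
    lam2 (p * n) (p * n + p * h) = lam2 n (n + h) := by
  unfold lam2
  rw [← mul_add, ArithmeticFunction.liouville_apply_mul, ArithmeticFunction.liouville_apply_mul]
  congr 1
  calc ArithmeticFunction.liouville p * ArithmeticFunction.liouville n *
        (ArithmeticFunction.liouville p * ArithmeticFunction.liouville (n + h))
      = (ArithmeticFunction.liouville p * ArithmeticFunction.liouville p) *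
          (ArithmeticFunction.liouville n * ArithmeticFunction.liouville (n + h)) := by ring
    _ = ArithmeticFunction.liouville n * ArithmeticFunction.liouville (n + h) := by
        rw [liouville_mul_self_eq_one hp, one_mul]

/-- The dilation identity: `∑_{m ≤ Y, p ∣ m} λ(m)λ(m+ph) = S_h(⌊Y/p⌋)`. -/
theorem sum_filter_dvd_eq_corr {p : ℕ} (hp : 0 < p) (h Y : ℕ) :
    ∑ m ∈ (Finset.Icc 1 Y).filter (p ∣ ·), lam2 m (m + p * h) = corr h (Y / p) := by
  unfold corr
  symm
  refine Finset.sum_nbij' (fun n => p * n) (fun m => m / p) ?_ ?_ ?_ ?_ ?_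
  · intro n hn
    rw [Finset.mem_Icc] at hn
    rw [Finset.mem_filter, Finset.mem_Icc]
    refine ⟨⟨?_, ?_⟩, Dvd.intro n rfl⟩
    · exact Nat.mul_pos hp (by omega)
    · have := (Nat.le_div_iff_mul_le hp).1 hn.2
      rw [mul_comm]
      exact this
  · intro m hm
    rw [Finset.mem_filter, Finset.mem_Icc] at hm
    rw [Finset.mem_Icc]
    refine ⟨?_, Nat.div_le_div_right hm.1.2⟩
    rw [Nat.le_div_iff_mul_le hp, one_mul]
    exact Nat.le_of_dvd (by omega) hm.2
  · intro n _
    exact Nat.mul_div_cancel_left n hp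
  · intro m hm
    rw [Finset.mem_filter] at hm
    exact Nat.mul_div_cancel' hm.2
  · intro n _
    exact (lam2_dilate hp.ne' n h).symm

/-- The fairness summand in dilated form:
`∑_{m ≤ Y} (p·1_{p∣m} − 1) λ(m)λ(m+ph) = p·S_h(⌊Y/p⌋) − S_{ph}(Y)`. -/
theorem fair_inner_eq {p : ℕ} (hp : 0 < p) (h Y : ℕ) :
    ∑ m ∈ Finset.Icc 1 Y, ((if p ∣ m then (p : ℝ) else 0) - 1) * lam2 m (m + p * h)
      = (p : ℝ) * corr h (Y / p) - corr (p * h) Y := by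
  simp only [sub_mul, Finset.sum_sub_distrib, one_mul]
  congr 1
  rw [← sum_filter_dvd_eq_corr hp h Y, Finset.mul_sum, Finset.sum_filter]
  refine Finset.sum_congr rfl fun m _ => ?_
  split_ifs <;> simp

/-- Same bin ⇒ close: `a / w = b / w` forces `|a − b| < w`. -/
theorem abs_sub_lt_of_div_eq {w a b : ℕ} (hw : 0 < w) (hab : a / w = b / w) :
    |(a : ℝ) - b| < w := by
  have ha : ((w * (a / w) + a % w : ℕ) : ℝ) = a := by exact_mod_cast Nat.div_add_mod a w
  have hb : ((w * (b / w) + b % w : ℕ) : ℝ) = b := by exact_mod_cast Nat.div_add_mod b w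
  have hma : ((a % w : ℕ) : ℝ) < w := by exact_mod_cast Nat.mod_lt a hw
  have hmb : ((b % w : ℕ) : ℝ) < w := by exact_mod_cast Nat.mod_lt b hw
  have h0a : (0 : ℝ) ≤ ((a % w : ℕ) : ℝ) := Nat.cast_nonneg _
  have h0b : (0 : ℝ) ≤ ((b % w : ℕ) : ℝ) := Nat.cast_nonneg _
  push_cast at ha hb
  rw [hab] at ha
  rw [abs_sub_lt_iff]
  constructor <;> linarith

/-- Dilated scales are close: `|⌊pN/q⌋ − N| ≤ |p − q|·N/q + 1`. -/
theorem abs_div_cast_sub_le {p q : ℕ} (N : ℕ) (hq : 0 < q) :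
    |(((p * N) / q : ℕ) : ℝ) - N| ≤ |(p : ℝ) - q| * N / q + 1 := by
  have hq' : (0 : ℝ) < q := by exact_mod_cast hq
  have h1 : (((p * N) / q : ℕ) : ℝ) ≤ ((p * N : ℕ) : ℝ) / q := Nat.cast_div_le
  have h2 : ((p * N : ℕ) : ℝ) / q - 1 ≤ (((p * N) / q : ℕ) : ℝ) := by
    have e : ((q * (p * N / q) + p * N % q : ℕ) : ℝ) = ((p * N : ℕ) : ℝ) := by
      exact_mod_cast Nat.div_add_mod (p * N) q
    have hlt : ((p * N % q : ℕ) : ℝ) < q := by exact_mod_cast Nat.mod_lt (p * N) hq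
    push_cast at e ⊢
    rw [div_sub_one hq'.ne', div_le_iff₀ hq']
    nlinarith
  have key : ((p * N : ℕ) : ℝ) / q - N = ((p : ℝ) - q) * N / q := by
    push_cast
    field_simp
  have h3 : |(((p * N) / q : ℕ) : ℝ) - N| ≤ |((p * N : ℕ) : ℝ) / q - N| + 1 := by
    rw [abs_le]
    constructor
    · have := neg_abs_le (((p * N : ℕ) : ℝ) / q - N)
      linarith
    · have := le_abs_self (((p * N : ℕ) : ℝ) / q - N)
      linarith
  calc |(((p * N) / q : ℕ) : ℝ) - N| ≤ |((p * N : ℕ) : ℝ) / q - N| + 1 := h3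
    _ = |(p : ℝ) - q| * N / q + 1 := by
        rw [key, abs_div, abs_mul, Nat.abs_cast, Nat.abs_cast]


/-! ## Registered stubs (`sorry` only here; signatures self-contained — Mathlib names and the
route item `PrimeLagChowla` by its fully qualified name) -/

/-- **F — DYADIC FAIRNESS AT EVERY LARGE SCALE (the load-bearing, open stub).** For every shift
`h ≥ 1`, every `ε > 0` and every `P₁` there is `P ≥ P₁` and `Y₀` such that for all `Y ≥ Y₀`:
`∑_{p prime, P ≤ p < 2P} |∑_{m=1}^{Y} (p·1_{p∣m} − 1)·λ(m)λ(m+ph)| ≤ ε · Y · #{p prime : P ≤ p < 2P}`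
— divisibility by `p` is (on `L¹`-average over the dyadic block) independent of the weight
`λ(m)λ(m+ph)`, at every large natural scale. Equivalently (exact identity `fair_inner_eq`)
`∑_p |p·S_h(⌊Y/p⌋) − S_{ph}(Y)| ≤ εY#𝒫`: the finitary Tao–Teräväinen improved isotopy formula
`sup_d E_{P≤p<2P}|f_{dp}(1) − f_d(p)| ≤ ε` (arXiv:1809.02518 Prop. 5.1, p. 26) without the
few-sign-patterns hypothesis. Plausibly true: implied by `ChowlaFixed` (both terms are binary Chowla
sums); known at logarithmic scale (Tao 2016 §3) and for prime sets with `∑1/p → ∞` at a fixed scale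
(Helfgott–Radziwiłł 2021). Why it might fail / what is open: one dyadic block, all large natural
scales — the entropy decrement locates a fair window only relative to a fixed distribution of `n`
(diagonal conspiracy, Tao 2016 p. 15); on this route it is to be derived from the door
`UniformEntropyRate` (information-theoretic half of `EntropyTransfer`, stmt-Parity-17880). Size:
open problem (natural-scale Chowla-hard modulo MRT). [cite: arXiv:1809.02518 §5 Prop. 5.1;
arXiv:1509.05422 §3 (Lemmas 3.2, 3.3, Prop. 2.6); arXiv:2103.06853 Cor. 1.1] -/
theorem stub_dyadicFairness :
    ∀ h : ℕ, 1 ≤ h → ∀ ε : ℝ, 0 < ε → ∀ P₁ : ℕ, ∃ P : ℕ, P₁ ≤ P ∧ ∃ Y₀ : ℕ, ∀ Y : ℕ, Y₀ ≤ Y →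
      ∑ p ∈ (Finset.Ico P (2 * P)).filter Nat.Prime,
          |∑ m ∈ Finset.Icc 1 Y, ((if p ∣ m then (p : ℝ) else 0) - 1) *
              (((ArithmeticFunction.liouville m * ArithmeticFunction.liouville (m + p * h) : ℤ)) : ℝ)|
        ≤ ε * Y * (((Finset.Ico P (2 * P)).filter Nat.Prime).card : ℝ) := by
  sorry

/-- **M — PRIME-LAG AVERAGED CHOWLA AT NATURAL SCALE (known; the route's support item
stmt-Parity-17878 BY NAME).** For `h ≥ 1`, `ε > 0`: for `P ≥ P₀` and `X ≥ X₀(P)`,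
`∑_{p prime, P ≤ p < 2P} |∑_{n=1}^{X} λ(n)λ(n+ph)| ≤ ε·X·#{p}` (absolute values INSIDE the `p`-sum).
Matomäki–Radziwiłł–Tao through Tao 2016 Lemmas 3.6–3.7 + eq. (2.9), whose coefficients `c_p` are
arbitrary unit phases (restriction theorem for the primes), so the `L¹`-over-primes form follows by
choosing signs; printed signed form vendored as
`Literature.NumberTheory.Sieve.taoTeravainen2019_primeLag_liouville` (TT19 p. 26). Size: L
(vendoring) / XL (from MR in Mathlib terms). [cite: arXiv:1509.05422 Lemmas 3.6, 3.7, (2.9);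
arXiv:1809.02518 p. 26; arXiv:1501.04585] -/
theorem stub_primeLagChowla :
    Summit.Parity.GeneralizedHardyLittlewood.Theses.EntropyRate.PrimeLagChowla := by
  sorry

/-! ## Legend: the stub statements as named propositions (verbatim the registered signatures;
keyed by the stub names for the native skeleton audit) -/

/-- Statement of `stub_dyadicFairness` (F), verbatim. -/
def Sig.stub_dyadicFairness : Prop :=
  ∀ h : ℕ, 1 ≤ h → ∀ ε : ℝ, 0 < ε → ∀ P₁ : ℕ, ∃ P : ℕ, P₁ ≤ P ∧ ∃ Y₀ : ℕ, ∀ Y : ℕ, Y₀ ≤ Y →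
      ∑ p ∈ (Finset.Ico P (2 * P)).filter Nat.Prime,
          |∑ m ∈ Finset.Icc 1 Y, ((if p ∣ m then (p : ℝ) else 0) - 1) *
              (((ArithmeticFunction.liouville m * ArithmeticFunction.liouville (m + p * h) : ℤ)) : ℝ)|
        ≤ ε * Y * (((Finset.Ico P (2 * P)).filter Nat.Prime).card : ℝ)

/-- Statement of `stub_primeLagChowla` (M), verbatim: the route item by name. -/
def Sig.stub_primeLagChowla : Prop :=
  Summit.Parity.GeneralizedHardyLittlewood.Theses.EntropyRate.PrimeLagChowla

/-! ## Composition: the crux BY NAME from the two stubs (real proof, no `sorry`) -/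

/-- **ChowlaFixed from F and M — the finitary descent.** Fix `h ≥ 1`; it suffices to bound
`|S_h(N)| ≤ cN` eventually for `c ∈ (0,1]`. With `δ = c/3`, `ε = c²/144`: `P₀` from M, a fair block
`[P,2P)` beyond `max P₀ (⌈2/δ⌉₊+2)` from F, non-empty by Bertrand; bins of width `w = ⌊δP⌋₊`,
`≤ P/w + 1 ≤ 3/δ` of them, one bin `B` with `#𝒫 ≤ (P/w+1)·#B` by pigeonhole, `p₀ ∈ B`. For
`N ≥ max Y₀ X₀ ⌈3/c⌉₊` apply F and M at `Y = p₀N`: `∑_{p∈𝒫} p|S_h(⌊Y/p⌋)| ≤ 2εY#𝒫` (`fair_inner_eq`,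
triangle inequality); on `B`, `|S_h(⌊p₀N/p⌋) − S_h(N)| ≤ δN+1` (same bin ⇒ `|p₀−p| < w ≤ δP`,
`abs_div_cast_sub_le`, `abs_corr_sub_le`), so `#B·P·(|S_h N| − δN − 1) ≤ 4εPN#𝒫 ≤ 4εPN(3/δ)#B`, i.e.
`|S_h(N)| ≤ δN + 1 + 12εN/δ = 7cN/12 + 1 ≤ cN`. -/
theorem ChowlaFixed_of : Sig.stub_dyadicFairness → Sig.stub_primeLagChowla → ChowlaFixed := by
  intro hF hM
  rw [chowlaFixed_iff]
  intro h hh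
  rw [Asymptotics.isLittleO_iff]
  -- it suffices to treat `c ≤ 1`
  suffices hsuff : ∀ c : ℝ, 0 < c → c ≤ 1 → ∀ᶠ N : ℕ in Filter.atTop, |corr h N| ≤ c * N by
    intro c hc
    have hc' : 0 < min c 1 := lt_min hc one_pos
    filter_upwards [hsuff (min c 1) hc' (min_le_right _ _)] with N hN
    rw [Real.norm_eq_abs, Real.norm_eq_abs, Nat.abs_cast]
    exact hN.trans (mul_le_mul_of_nonneg_right (min_le_left _ _) (Nat.cast_nonneg _))
  intro c hc hc1
  -- parameters `δ = c/3`, `ε = c²/144` (so that `12 ε / δ = c / 4`)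
  set δ : ℝ := c / 3 with hδdef
  set ε : ℝ := c ^ 2 / 144 with hεdef
  have hδ : 0 < δ := by positivity
  have hδ1 : δ ≤ 1 / 3 := by rw [hδdef]; linarith
  have hε : 0 < ε := by positivity
  -- the prime-lag threshold `P₀` and a fair dyadic block `[P, 2P)` beyond `max P₀ (⌈2/δ⌉₊ + 2)`
  obtain ⟨P₀, hP₀⟩ := hM h hh ε hε
  obtain ⟨P, hP₁P, Y₀, hY₀⟩ := hF h hh ε hε (max P₀ (⌈2 / δ⌉₊ + 2))
  have hP₀P : P₀ ≤ P := le_trans (le_max_left _ _) hP₁P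
  have hP2 : ⌈2 / δ⌉₊ + 2 ≤ P := le_trans (le_max_right _ _) hP₁P
  have h2P : 2 ≤ P := le_trans (Nat.le_add_left 2 _) hP2
  have hPpos : 0 < P := by omega
  have hPreal : (0 : ℝ) < P := by exact_mod_cast hPpos
  have hδP : 2 ≤ δ * P := by
    have h1 : (2 / δ : ℝ) ≤ ⌈2 / δ⌉₊ := Nat.le_ceil _
    have h2 : ((⌈2 / δ⌉₊ + 2 : ℕ) : ℝ) ≤ P := by exact_mod_cast hP2
    push_cast at h2
    have h3 : 2 / δ ≤ (P : ℝ) := by linarith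
    rw [div_le_iff₀ hδ] at h3
    linarith
  obtain ⟨X₀, hX₀⟩ := hP₀ P hP₀P
  -- the prime block
  set PB : Finset ℕ := (Finset.Ico P (2 * P)).filter Nat.Prime with hPBdef
  have hmemPB : ∀ p ∈ PB, P ≤ p ∧ p < 2 * P ∧ p.Prime := by
    intro p hp
    rw [hPBdef, Finset.mem_filter, Finset.mem_Ico] at hp
    exact ⟨hp.1.1, hp.1.2, hp.2⟩
  -- it is nonempty (Bertrand)
  obtain ⟨q, hq, hPq, hq2P⟩ := Nat.exists_prime_lt_and_le_two_mul P (by omega)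
  have hqPB : q ∈ PB := by
    rw [hPBdef, Finset.mem_filter, Finset.mem_Ico]
    refine ⟨⟨hPq.le, lt_of_le_of_ne hq2P ?_⟩, hq⟩
    intro hq2
    rw [hq2] at hq
    rcases hq.eq_one_or_self_of_dvd 2 (Dvd.intro P rfl) with h21 | h22
    · omega
    · omega
  have hPBpos : 0 < PB.card := Finset.card_pos.2 ⟨q, hqPB⟩
  have hPBreal : (0 : ℝ) < PB.card := by exact_mod_cast hPBpos
  -- bins of width `w = ⌊δ P⌋₊` on `[P, 2P)`: `nb = P / w + 1 ≤ 3/δ` of them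
  set w : ℕ := ⌊δ * P⌋₊ with hwdef
  have hw1 : 1 ≤ w := by
    rw [hwdef]
    apply Nat.le_floor
    push_cast
    linarith
  have hwpos : 0 < w := hw1
  have hwreal : (0 : ℝ) < w := by exact_mod_cast hwpos
  have hwle : (w : ℝ) ≤ δ * P := Nat.floor_le (by positivity)
  have hwge : δ * P / 2 ≤ w := by
    have := Nat.lt_floor_add_one (δ * P)
    rw [← hwdef] at this
    linarith
  set nb : ℕ := P / w + 1 with hnbdef
  have hnbpos : (0 : ℝ) < nb := by rw [hnbdef]; positivity
  have hnb_le : (nb : ℝ) ≤ 3 / δ := by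
    have h1 : ((P / w : ℕ) : ℝ) ≤ (P : ℝ) / w := Nat.cast_div_le
    have h2 : (P : ℝ) / w ≤ 2 / δ := by
      rw [div_le_iff₀ hwreal]
      calc (P : ℝ) = 2 / δ * (δ * P / 2) := by field_simp
        _ ≤ 2 / δ * w := by gcongr
    have h3 : (1 : ℝ) ≤ 1 / δ := by
      rw [le_div_iff₀ hδ]
      linarith
    have h4 : (nb : ℝ) = ((P / w : ℕ) : ℝ) + 1 := by rw [hnbdef]; push_cast; ring
    rw [h4]
    calc ((P / w : ℕ) : ℝ) + 1 ≤ 2 / δ + 1 / δ := by linarith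
      _ = 3 / δ := by ring
  have hmaps : ∀ p ∈ PB, (p - P) / w ∈ Finset.range nb := by
    intro p hp
    obtain ⟨hPp, hp2P, -⟩ := hmemPB p hp
    rw [Finset.mem_range, hnbdef, Nat.lt_add_one_iff]
    exact Nat.div_le_div_right (by omega)
  -- pigeonhole: a bin `F` holding at least `#PB / nb` of the primes
  obtain ⟨i, -, hfib⟩ := Finset.exists_le_card_fiber_of_nsmul_le_card_of_maps_to hmaps
    ⟨0, Finset.mem_range.2 (by rw [hnbdef]; exact Nat.succ_pos _)⟩ (b := (PB.card : ℝ) / nb) (by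
      rw [Finset.card_range, nsmul_eq_mul]
      have : (nb : ℝ) * ((PB.card : ℝ) / nb) = PB.card := by field_simp
      rw [this])
  set F : Finset ℕ := PB.filter (fun p => (p - P) / w = i) with hFdef
  have hFsub : F ⊆ PB := Finset.filter_subset _ _
  have hFcard : (PB.card : ℝ) ≤ nb * F.card := by
    rw [div_le_iff₀ hnbpos] at hfib
    linarith
  have hFpos : 0 < F.card := by
    have h1 : (0 : ℝ) < (PB.card : ℝ) / nb := by positivity
    have h2 : (0 : ℝ) < F.card := by linarith
    exact_mod_cast h2
  obtain ⟨p₀, hp₀F⟩ := Finset.card_pos.1 hFpos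
  have hp₀PB : p₀ ∈ PB := hFsub hp₀F
  obtain ⟨hPp₀, hp₀2P, hp₀prime⟩ := hmemPB p₀ hp₀PB
  have hp₀pos : 0 < p₀ := hp₀prime.pos
  have hp₀bin : (p₀ - P) / w = i := (Finset.mem_filter.1 hp₀F).2
  -- from here on: every `N ≥ max (max Y₀ X₀) ⌈3/c⌉₊`
  rw [Filter.eventually_atTop]
  refine ⟨max (max Y₀ X₀) ⌈3 / c⌉₊, fun N hN => ?_⟩
  have hNY : Y₀ ≤ N := le_trans (le_trans (le_max_left _ _) (le_max_left _ _)) hN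
  have hNX : X₀ ≤ N := le_trans (le_trans (le_max_right _ _) (le_max_left _ _)) hN
  have hNc : 3 / c ≤ (N : ℝ) :=
    le_trans (Nat.le_ceil _) (by exact_mod_cast le_trans (le_max_right _ _) hN)
  have hcN : 3 ≤ c * N := by
    rw [div_le_iff₀ hc] at hNc
    linarith
  have hNnn : (0 : ℝ) ≤ N := Nat.cast_nonneg _
  -- the scale `Y = p₀ N`
  set Y : ℕ := p₀ * N with hYdef
  have hNleY : N ≤ Y := Nat.le_mul_of_pos_left N hp₀pos
  have hYY₀ : Y₀ ≤ Y := hNY.trans hNleY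
  have hYX₀ : X₀ ≤ Y := hNX.trans hNleY
  have hYle : (Y : ℝ) ≤ 2 * P * N := by
    have h1 : (p₀ : ℝ) ≤ 2 * P := by exact_mod_cast hp₀2P.le
    have h2 : (Y : ℝ) = p₀ * N := by rw [hYdef]; push_cast; ring
    rw [h2]
    exact mul_le_mul_of_nonneg_right h1 hNnn
  -- the two inputs at scale `Y`
  have hfair : ∑ p ∈ PB, |∑ m ∈ Finset.Icc 1 Y, ((if p ∣ m then (p : ℝ) else 0) - 1) *
      lam2 m (m + p * h)| ≤ ε * Y * PB.card := hY₀ Y hYY₀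
  have hmrt : ∑ p ∈ PB, |corr (p * h) Y| ≤ ε * Y * PB.card := hX₀ Y hYX₀
  -- (3): `∑_{p ∈ PB} p |S_h(⌊Y/p⌋)| ≤ 2 ε Y #PB`
  have h3 : ∑ p ∈ PB, (p : ℝ) * |corr h (Y / p)| ≤ 2 * ε * Y * PB.card := by
    have hpt : ∀ p ∈ PB, (p : ℝ) * |corr h (Y / p)| ≤
        |∑ m ∈ Finset.Icc 1 Y, ((if p ∣ m then (p : ℝ) else 0) - 1) * lam2 m (m + p * h)| +
          |corr (p * h) Y| := by
      intro p hp
      have hppos : 0 < p := (hmemPB p hp).2.2.pos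
      have hpreal : (0 : ℝ) ≤ p := Nat.cast_nonneg _
      rw [fair_inner_eq hppos h Y]
      have e : (p : ℝ) * |corr h (Y / p)| = |(p : ℝ) * corr h (Y / p)| := by
        rw [abs_mul, abs_of_nonneg hpreal]
      rw [e]
      have := abs_add_le ((p : ℝ) * corr h (Y / p) - corr (p * h) Y) (corr (p * h) Y)
      rwa [sub_add_cancel] at this
    calc ∑ p ∈ PB, (p : ℝ) * |corr h (Y / p)|
        ≤ ∑ p ∈ PB, (|∑ m ∈ Finset.Icc 1 Y, ((if p ∣ m then (p : ℝ) else 0) - 1) *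
            lam2 m (m + p * h)| + |corr (p * h) Y|) := Finset.sum_le_sum hpt
      _ = ∑ p ∈ PB, |∑ m ∈ Finset.Icc 1 Y, ((if p ∣ m then (p : ℝ) else 0) - 1) *
            lam2 m (m + p * h)| + ∑ p ∈ PB, |corr (p * h) Y| := Finset.sum_add_distrib
      _ ≤ ε * Y * PB.card + ε * Y * PB.card := add_le_add hfair hmrt
      _ = 2 * ε * Y * PB.card := by ring
  -- restricted to the populated bin
  have h3F : ∑ p ∈ F, (p : ℝ) * |corr h (Y / p)| ≤ 2 * ε * Y * PB.card :=
    le_trans (Finset.sum_le_sum_of_subset_of_nonneg hFsub (fun p _ _ => by positivity)) h3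
  -- dilated scales in the bin are `δ N + 1`-close to `N`
  have hclose : ∀ p ∈ F, |corr h (Y / p) - corr h N| ≤ δ * N + 1 := by
    intro p hpF
    have hpPB : p ∈ PB := hFsub hpF
    obtain ⟨hPp, hp2P, hpprime⟩ := hmemPB p hpPB
    have hppos : 0 < p := hpprime.pos
    have hpreal : (0 : ℝ) < p := by exact_mod_cast hppos
    have hpbin : (p - P) / w = i := (Finset.mem_filter.1 hpF).2
    have hdist : |(p₀ : ℝ) - p| < w := by
      have := abs_sub_lt_of_div_eq hwpos (hp₀bin.trans hpbin.symm)
      rwa [Nat.cast_sub hPp₀, Nat.cast_sub hPp, sub_sub_sub_cancel_right] at this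
    have hPlep : (P : ℝ) ≤ p := by exact_mod_cast hPp
    calc |corr h (Y / p) - corr h N| ≤ |((Y / p : ℕ) : ℝ) - N| := abs_corr_sub_le h _ _
      _ ≤ |(p₀ : ℝ) - p| * N / p + 1 := by rw [hYdef]; exact abs_div_cast_sub_le N hppos
      _ ≤ (w : ℝ) * N / P + 1 := by
          have h1 : |(p₀ : ℝ) - p| * N / p ≤ (w : ℝ) * N / p :=
            div_le_div_of_nonneg_right (mul_le_mul_of_nonneg_right hdist.le hNnn) hpreal.le
          have h2 : (w : ℝ) * N / p ≤ (w : ℝ) * N / P :=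
            div_le_div_of_nonneg_left (by positivity) hPreal hPlep
          linarith
      _ ≤ δ * N + 1 := by
          have h1 : (w : ℝ) * N / P ≤ δ * P * N / P :=
            div_le_div_of_nonneg_right (mul_le_mul_of_nonneg_right hwle hNnn) hPreal.le
          have h2 : δ * P * N / P = δ * N := by field_simp
          linarith
  -- conclusion
  by_cases hsmall : |corr h N| ≤ δ * N + 1
  · have : δ * N + 1 ≤ c * N := by rw [hδdef]; linarith
    exact hsmall.trans this
  · rw [not_le] at hsmall
    set x : ℝ := |corr h N| - (δ * N + 1) with hxdef
    have hxpos : 0 < x := by rw [hxdef]; linarith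
    have hlow : ∀ p ∈ F, (P : ℝ) * x ≤ (p : ℝ) * |corr h (Y / p)| := by
      intro p hpF
      obtain ⟨hPp, -, -⟩ := hmemPB p (hFsub hpF)
      have h1 : x ≤ |corr h (Y / p)| := by
        have h2 := hclose p hpF
        have h3 := abs_sub_abs_le_abs_sub (corr h N) (corr h (Y / p))
        rw [abs_sub_comm] at h3
        rw [hxdef]
        linarith
      have h2 : (P : ℝ) ≤ p := by exact_mod_cast hPp
      exact mul_le_mul h2 h1 hxpos.le (Nat.cast_nonneg _)
    have hsum : (F.card : ℝ) * ((P : ℝ) * x) ≤ 2 * ε * Y * PB.card := by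
      have := Finset.sum_le_sum hlow
      rw [Finset.sum_const, nsmul_eq_mul] at this
      exact this.trans h3F
    have hFreal : (0 : ℝ) < F.card := by exact_mod_cast hFpos
    have hx_le : x ≤ 4 * ε * N * nb := by
      have h1 : 2 * ε * (Y : ℝ) * PB.card ≤ 2 * ε * (2 * P * N) * (nb * F.card) := by
        have ha : 2 * ε * (Y : ℝ) * PB.card ≤ 2 * ε * (2 * P * N) * PB.card :=
          mul_le_mul_of_nonneg_right (mul_le_mul_of_nonneg_left hYle (by positivity)) hPBreal.le
        have hb : 2 * ε * (2 * P * N) * (PB.card : ℝ) ≤ 2 * ε * (2 * P * N) * (nb * F.card) :=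
          mul_le_mul_of_nonneg_left hFcard (by positivity)
        linarith
      have h2 : (F.card : ℝ) * ((P : ℝ) * x) ≤ (F.card : ℝ) * ((P : ℝ) * (4 * ε * N * nb)) := by
        calc (F.card : ℝ) * ((P : ℝ) * x) ≤ 2 * ε * (2 * P * N) * (nb * F.card) := hsum.trans h1
          _ = (F.card : ℝ) * ((P : ℝ) * (4 * ε * N * nb)) := by ring
      have h3 := le_of_mul_le_mul_left h2 hFreal
      exact le_of_mul_le_mul_left h3 hPreal
    have hx_le' : x ≤ c * N / 4 := by
      have h1 : 4 * ε * (N : ℝ) * nb ≤ 4 * ε * N * (3 / δ) :=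
        mul_le_mul_of_nonneg_left hnb_le (by positivity)
      have e : 4 * ε * (N : ℝ) * (3 / δ) = c * N / 4 := by
        rw [hεdef, hδdef]
        field_simp
        ring
      linarith
    have e : |corr h N| = x + (δ * N + 1) := by rw [hxdef]; ring
    rw [e, hδdef]
    linarith

/-- The skeleton in its final shape: the crux BY NAME from the two registered stubs (it becomes a
proof of the crux when `stub_dyadicFairness` and `stub_primeLagChowla` are discharged; until then it
depends on `sorryAx` through the stubs only — no `sorry` of its own). [bookkeeping] -/
theorem ChowlaFixed_proof : ChowlaFixed :=
  ChowlaFixed_of stub_dyadicFairness stub_primeLagChowla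

end Summit.Parity.GeneralizedHardyLittlewood.Cruxes.ChowlaFixed.Birth

end
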